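import Summits.QuantumFields.BalabanUV.Beta.FP.StepLawKHolds
import Summits.QuantumFields.BalabanUV.Beta.FP.FineHessianNearLedgerCore
import Summits.QuantumFields.BalabanUV.Beta.FP.FineHessianGluonCore
import Summits.QuantumFields.BalabanUV.Beta.FP.PerfectPolarizationWard

/-!
# `BalabanUV.Beta.FP.SliceLegRemainderBounded` — road «FP» for binder row D1, row **IR-5′** ∕ PART 3b class #7 `hRb` AT THE LEFT PLACEMENT, PER `m`, UNCONDITIONAL:
# the slice-leg remainder `R m := blk (KPerf m) tt − c m • blk Pker tt` (the ff block of the UNDRESSED perfect resolvent minus the scaled BF propagator — the reading of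
# `RoadAsympEndLeft`'s implicit `R` under `hslice`'s leg `c m • blk Pker tt + R m`) is BOUNDED for every `m ≥ 1`, with a constant allowed to depend on `m` (census
# `RESIDUAL-FP.md` §9 row #7: «`Γ` bounded ⟸ IR-5′ (PRINTED) or … soft bound (per m, allowed)») — by name over gan24's K-side (`StepLawKHolds.exists_decays_KPerf_holds`) and
# the BF leg's bound (`PerfectPolarizationWard.bdd_Pker`); NO `Prop12Printed`

HONEST DEPENDENCY (page 1, mandatory): continuum YM on T⁴ ⇐ BetaPertH ∧ nine spine estimates (0/9 proved); BetaPertH ⇐ (D1) ∧ (D4) ∧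
CAP+tail; G-an2-4 gates asym, D1 and NE2/3/4.  HONEST FRAMING (cell contract, verbatim): «discharging `BetaPertH` makes Bałaban's UV
stability UNCONDITIONAL — a real constructive-QFT result; it is NOT the continuum limit and NOT the Clay problem.»  THIS MODULE is [folklore] `Bdd` bookkeeping + ONE
composition BY NAME; it defines nothing, cites nothing, mints no `Prop` fact, 0 sorry.  The bound is PER `m` (gan24's per-`m` `Decays` constant); the m-UNIFORM sup letter of the
perfect ff block is NOT claimed (journal N-d1leaf05g16-1 ∕ Q-d1leaf05g16-2).  NOT `hslice` (which FIXES `R m`; here the natural LEFT reading is displayed in the statement, for the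
owner to confirm), NOT `hfar`, NOT (ASYMP), NOT D1; 0∕4 row-D1 binders; NOT BetaPertH, NOT continuum, NOT Clay.

ABSOLUTE RULE (cell charter, verbatim): «No internally-minted statement may enter as a cited fact. Every hypothesis is either kernel-proved in this
package or a verbatim quotation of a PUBLISHED theorem with page reference. The manuscript(s) under audit are NOT citable for their own disputed
steps — they are the thing under adjudication; programme-internal (2001/route/tribunal) claims are never citable.»

CONTENT ([folklore] unless marked): `bdd_of_decays` (`Decays K C δ`, `0 ≤ δ` ⟹ `Bdd K C`), `bdd_sub`, `exists_bdd_KPerf` ([our object] `∀ m ≥ 1, ∃ C, Bdd (KPerf … m) C`, `2 ≤ Lc`),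
**`exists_bdd_sliceLegRemainder_left`** ([our object] `∀ m ≥ 1, ∃ CR, Bdd (blk (KPerf … m) true true − c m • blk Pker true true) CR` for ANY real sequence `c` — the `hRb` binder of
`RoadAsympEndLeft.hasym_PiBF_of_sliceLedger_left` ∕ `RoadLeftAssembly*` at `R m := blk (KPerf m) tt − c m • blk Pker tt`).
Provenance: D1 formalisation swarm LEAF PROVER 05, unit `b2b-balaban-beta-d1-formalise-leaf-05` gen 16, 2026-08-21, road FP row IR-5′ ∕ #7; «not in print; our bookkeeping».
-/

noncomputable section

namespace Summit.QuantumFields.BalabanUV.Beta.FP.SliceLegRemainderBounded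

open Literature.MathematicalPhysics.QuantumFieldTheory.Balaban1983to89
open Literature.MathematicalPhysics.QuantumFieldTheory.Balaban1983to89.Beta
open B12Sec2to5 (l1 l1_nonneg)
open ExpKernelCalculus (MKer Decays)
open OneStepResolventKernel (Fib)
open KernelWard (Bdd)
open Summit.QuantumFields.BalabanUV.Beta.D1BFx.PackedKernelSplit (blk)
open Summit.QuantumFields.BalabanUV.Beta.GAN24.CombesThomas (sfStep smStep)
open Summit.QuantumFields.BalabanUV.Beta.FP.PerfectObjectsT (KPerf)
open Summit.QuantumFields.BalabanUV.Beta.FP.PerfectPolarization (Pker)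
open Summit.QuantumFields.BalabanUV.Beta.FP.PerfectPropagatorLegData (A0P)
open Summit.QuantumFields.BalabanUV.Beta.FP.PerfectPolarizationWard (bdd_Pker)
open Summit.QuantumFields.BalabanUV.Beta.FP.FineHessianNearLedgerCore (bdd_blk)
open Summit.QuantumFields.BalabanUV.Beta.FP.FineHessianGluonCore (bdd_smul)
open Summit.QuantumFields.BalabanUV.Beta.FP.StepLawKHolds (exists_decays_KPerf_holds)

/-! ## §1 `Bdd` bookkeeping -/

section BddLemmas

variable {D : ℕ} {F : Type*}

/-- [folklore] an exponentially decaying kernel (nonnegative rate) is bounded by its amplitude. -/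
theorem bdd_of_decays {K : MKer D F} {C δ : ℝ} (h : Decays K C δ) (hδ : 0 ≤ δ) : Bdd K C := by
  intro x y a b
  have hC : 0 ≤ C := h.nonneg a
  refine (h x y a b).trans ?_
  have hexp : Real.exp (-δ * l1 (x - y)) ≤ 1 := by
    rw [Real.exp_le_one_iff, neg_mul, neg_nonpos]
    exact mul_nonneg hδ (l1_nonneg _)
  calc C * Real.exp (-δ * l1 (x - y)) ≤ C * 1 := mul_le_mul_of_nonneg_left hexp hC
    _ = C := mul_one C

/-- [folklore] differences of bounded kernels are bounded. -/
theorem bdd_sub {K L : MKer D F} {B B' : ℝ} (hK : Bdd K B) (hL : Bdd L B') : Bdd (K - L) (B + B') := by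
  intro x y a b
  show |K x y a b - L x y a b| ≤ B + B'
  exact (abs_sub _ _).trans (add_le_add (hK x y a b) (hL x y a b))

end BddLemmas

/-! ## §2 The perfect resolvent and the slice-leg remainder are bounded, per `m` -/

variable {Lc : ℕ} [NeZero Lc]

/-- [our object] **THE PERFECT `m`-FOLD RESOLVENT IS BOUNDED, PER `m`** (`2 ≤ Lc`, `m ≥ 1`): `∃ C, Bdd (KPerf Lc (sfStep Lc) (smStep 3 Lc) m) C` — gan24's unconditional
per-`m` `Decays` (`StepLawKHolds.exists_decays_KPerf_holds`) with the exponential dropped. -/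
theorem exists_bdd_KPerf (hLc : 2 ≤ Lc) {m : ℕ} (hm : 1 ≤ m) : ∃ C : ℝ, Bdd (KPerf (d := 3) Lc (sfStep Lc) (smStep 3 Lc) m) C := by
  obtain ⟨C, δ, hδ, hK⟩ := exists_decays_KPerf_holds hLc hm
  exact ⟨C, bdd_of_decays hK hδ.le⟩

/-- **CLASS #7 `hRb` AT THE LEFT PLACEMENT, PER `m`, UNCONDITIONAL** [our object] (`2 ≤ Lc`; ANY real sequence `c`): for every `m ≥ 1` there is `CR` with
`Bdd (blk (KPerf … m) true true − c m • blk Pker true true) CR` — the binder `hRb : ∀ m ≥ 1, ∃ CR, Bdd (R m) CR` of `RoadAsympEndLeft.hasym_PiBF_of_sliceLedger_left` (hence of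
`RoadLeftAssembly.d1Drift_left_of_sliceLedger` and its `SDF`∕`Rows` forms) at the reading `R m := blk (KPerf m) tt − c m • blk Pker tt` of the slice-leg remainder, i.e. the one for
which `hslice`'s leg `c m • blk Pker tt + R m` IS the ff block of the undressed perfect resolvent.  `CR := C(m) + |c m|·A0P`. -/
theorem exists_bdd_sliceLegRemainder_left (hLc : 2 ≤ Lc) (c : ℕ → ℝ) :
    ∀ m : ℕ, 1 ≤ m → ∃ CR : ℝ, Bdd (blk (KPerf (d := 3) Lc (sfStep Lc) (smStep 3 Lc) m) true true - c m • blk Pker true true) CR := by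
  intro m hm
  obtain ⟨C, hK⟩ := exists_bdd_KPerf hLc hm
  exact ⟨C + |c m| * A0P, bdd_sub (bdd_blk hK true true) (bdd_smul (bdd_blk bdd_Pker true true) (c m))⟩

end Summit.QuantumFields.BalabanUV.Beta.FP.SliceLegRemainderBounded

end
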